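import Literature.NumberTheory.ComplexMultiplication.CMTypeHarrisTaylorSignatureReflexField
import Literature.NumberTheory.ComplexMultiplication.CMTypeDistinguishedElementReflexField
import HarnessLib

/-!
# The reflex field of a CM type with the Harris–Taylor / Rapoport–Smithling–Zhang signature relative to `(Φ₀, φ₀)`
# over a subfield `k₀ ≤ K` of ANY degree is the compositum `K* = E_{Φ₀} · σ₀(K)`; its stabiliser in `Aut(ℂ)` is
# `Stab(Φ₀) ∩ Stab(σ₀) = Stab(m) ∩ Stab(σ₀)`; and RSZ's reflex field `E = E_{Φ₀} · φ₀(k₀)` lies in `K*`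

Layer `Literature/NumberTheory/ComplexMultiplication`, namespace `Literature.NumberTheory.ComplexMultiplication` (lane
`lit-hodgefound`, Track 2 foundations, Layer A3; seat `lit-hodgefound-p11`, generation 28, row g28-#2).  Sequel of
`CMTypeHarrisTaylorSignatureReflexField` (g27-#4: `σ₀(K) ⊆ K*`, and `K* = σ₀(K)` when `Aut(ℂ/φ₀(k₀))` fixes `Hom(k₀, ℂ)`)
and of `CMTypeDistinguishedElementReflexField` (g28-#1: RSZ's reflex field `E = E_{Φ₀} · φ₀(k₀)` of the datum
`(k₀, Φ₀, φ₀)`, eq. (3.1)).  THEOREMS ONLY (D-0026): no definition, no named fact, no instance.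

THE PRINT.  M. Rapoport, B. Smithling, W. Zhang, *Arithmetic diagonal cycles on unitary Shimura varieties*
[RapoportSmithlingZhang2017] (arXiv:1710.06962v3): Introduction p. 2 «We fix a CM type `Φ` of `F` and a distinguished
element `φ₀ ∈ Φ`.  Let `n ≥ 2` and let `r : Hom(F, ℂ) → {0, 1, n−1, n}` […] `r_φ := 1` (`φ = φ₀`), `0` (`φ ∈ Φ ∖ {φ₀}`),
`n − r_φ̄` (`φ ∉ Φ`) […] the field `E ⊂ ℚ̄` which is the composite of the reflex field of `r` and the reflex field of
`Φ`»; §3.1 p. 9 eq. (3.1) «`Aut(ℂ/E) = {σ ∈ Aut(ℂ) ∣ σΦ = Φ and σφ₀ = φ₀}`»; §3.2 p. 10 (the moduli problem over `E`):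
«`A` is an abelian variety over `S`, `ι : F → End⁰(A)` […] satisfying the Kottwitz condition of signature
`((1, n−1)_{φ₀}, (0, n)_{φ ∈ Φ ∖ {φ₀}})`».  B. Howard, *Complex multiplication cycles and Kudla–Rapoport divisors*,
Ann. of Math. 176 (2012) [Howard2012] §3.1: for `K₀` imaginary quadratic «there is a unique `φ^{sp} ∈ Φ` whose restriction
to `K₀` is `ῑ` […] `K_Φ = φ^{sp}(K)`».  G. Shimura (1998) [Shimura1998] §8.3 Prop. 28 (`K* = ℚ(tr_Φ)`; «`γS = S` iff `γ`
fixes `K*`»).  S. Lang, *Algebra* [Lang2002] Ch. VIII §1 (the fixed field of `Aut(ℂ/M)` is `M` for countable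
`M ⊂ ℂ`, the tree's `Complex.mem_subfield_of_forall_ringEquiv`).

THE MODEL (as in g27-#4 / g28-#1: `Aut(ℂ) = ℂ ≃+* ℂ` acting on embeddings by composition).  `K` a number field,
`k₀ : IntermediateField ℚ K` of ANY degree, `n = [K : k₀]`, `Φ : CMType K` (the type of a CM point of RSZ's moduli
problem: `ι : K → End⁰(A)`, `[K : ℚ] = 2 dim A = 2n[k₀ : ℚ]`), its `k₀`-SIGNATURE
`m_ψ = #{φ ∈ Φ ∣ φ|_{k₀} = ψ}` written out as `{φ | φ ∈ Φ.1 ∧ φ.comp (algebraMap k₀ K) = ψ}.ncard`, and RSZ's datum on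
`F = k₀`: a CM type `Φ₀ : CMType k₀` with its distinguished element `φ₀ ∈ Φ₀`.  THE KOTTWITZ CONDITION OF SIGNATURE
`((1, n−1)_{φ₀}, (0, n)_{ψ ∈ Φ₀ ∖ {φ₀}})` is «`m = r`», i.e. the hypotheses `h1 : m_{φ₀} = 1` and
`hΦ₀ : m_ψ = 0` for `ψ ∈ Φ₀ ∖ {φ₀}` (the third clause `m_ψ = n − m_ψ̄` holds for every CM type,
`ncard_inter_fibre_add_ncard_inter_fibre_conjugate`); `σ₀ ∈ Φ` denotes the SPECIAL ELEMENT above `φ₀`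
(`hσ₀ : σ₀ ∈ Φ.1`, `hσ₀ψ : σ₀|_{k₀} = φ₀`; it exists and is unique, `ncard_inter_fibre_eq_one_iff_exists_special`).

WHAT IS PROVED.

§1 the Kottwitz condition relative to `(Φ₀, φ₀)` versus g27-#4's Harris–Taylor hypotheses: `ncard_inter_fibre_eq_sub_of_not_mem`
   (`m_ψ = n − m_ψ̄`, the third clause of `r`, any `Φ`), `ncard_inter_fibre_eq_zero_or_eq_of_rsz` (`⟹` g27-#4's `hban`),
   `ncard_inter_fibre_eq_of_not_mem_of_ne_of_rsz` (`m_ψ = n` off `Φ₀ ∪ {φ̄₀}`), and conversely (`n ≥ 3`)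
   **`exists_cmType_rsz_of_harrisTaylor`**: the Harris–Taylor hypotheses come from a unique `Φ₀ ∋ φ₀`, namely `Φ₀ = {m ≤ 1}`
   (`mem_iff_ncard_inter_fibre_le_one_of_rsz`).
§2 stabilisers (`K` CM): `ncard_inter_fibre_smul_eq_of_forall_smul_mem_iff` (`τΦ = Φ ⟹ m_{τψ} = m_ψ`, ANY `Φ`),
   **`forall_smul_mem_iff_of_forall_ncard_inter_fibre_smul_eq_of_smul_special_eq`** (`m ∘ τ = m ∧ τσ₀ = σ₀ ⟹ τΦ = Φ`, any `n`;
   g27-#4's `forall_smul_mem_iff_of_smul_special_eq_of_harrisTaylor` is the case where `τ` fixes `Hom(k₀, ℂ)`),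
   **`forall_smul_mem_iff_iff_of_harrisTaylor`** (`n ≥ 3`: `Stab(Φ) = Stab(m) ∩ Stab(σ₀)`); relative to `Φ₀`:
   `forall_smul_mem_iff_of_forall_smul_mem_iff_of_smul_special_eq_of_rsz` (`τΦ₀ = Φ₀ ∧ τσ₀ = σ₀ ⟹ τΦ = Φ`, any `n`),
   `forall_smul_mem_iff_base_of_forall_smul_mem_iff_of_rsz` (`n ≥ 3`: `τΦ = Φ ⟹ τΦ₀ = Φ₀`),
   **`forall_smul_mem_iff_iff_of_rsz`** (`n ≥ 3`: `Stab(Φ) = Stab(Φ₀) ∩ Stab(σ₀)`; `τΦ = Φ ⟹ τφ₀ = φ₀` is g27-#4's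
   `smul_eq_of_forall_smul_mem_iff_of_harrisTaylor`, not restated).
§3 reflex fields (`K` CM, `n ≥ 3`): **`traceField_eq_traceField_sup_fieldRange_of_rsz`: `K* = E_{Φ₀} · σ₀(K)`** (Howard's
   «`K_Φ = φ^{sp}(K)`» for `k₀` of any degree: the factor `E_{Φ₀}` is invisible for `k₀` imaginary quadratic, where
   `E_{Φ₀} = φ₀(k₀) ⊆ σ₀(K)`), `traceField_base_le_traceField_of_rsz` (`E_{Φ₀} ⊆ K*`),
   **`traceField_sup_fieldRange_le_traceField_of_rsz`: RSZ's `E = E_{Φ₀} · φ₀(k₀) ⊆ K*`**, `mem_traceField_iff_forall_of_rsz` /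
   `mem_traceField_iff_forall_of_harrisTaylor` (`K*` is the fixed field of `Stab(Φ₀) ∩ Stab(σ₀)` = of `Stab(m) ∩ Stab(σ₀)`),
   degrees (`[K : ℚ] ∣ [K* : ℚ]`, `[E_{Φ₀} : ℚ] ∣ [K* : ℚ]`, `[E : ℚ] ∣ [K* : ℚ]`, `[K* : ℚ] ≤ [E_{Φ₀} : ℚ]·[K : ℚ]`), and
   `traceField_eq_fieldRange_iff_of_rsz` (`K* = σ₀(K) ⟺ E_{Φ₀} ⊆ σ₀(K) ⟺ Stab(σ₀) ≤ Stab(Φ₀)`; g27-#4's `hfix` case).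

## References

* [RapoportSmithlingZhang2017] M. Rapoport, B. Smithling, W. Zhang, *Arithmetic diagonal cycles on unitary Shimura
  varieties*, Compositio Math. 156 (2020); arXiv:1710.06962v3 Introduction p. 2, §3.1 eq. (3.1), §3.2 p. 10.
* [Howard2012] B. Howard, *Complex multiplication cycles and Kudla–Rapoport divisors*, Ann. of Math. (2) 176 (2012), §3.1.
* [Shimura1998] G. Shimura, *Abelian Varieties with Complex Multiplication and Modular Functions* (1998), §8.3 Prop. 28,
  §18.2 Lemma (i).
* [Lang2002] S. Lang, *Algebra*, 3rd ed. (2002), Ch. VIII §1.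
* [MilneFT2022] J. S. Milne, *Fields and Galois Theory* (2022), Prop. 1.20, Prop. 2.7, Cor. 3.10.

## Provenance

Lane `lit-hodgefound` (HOME `run/shared/lean/pub/lit-hodgefound/`), prover seat `lit-hodgefound-p11` (gen 28),
self-proposed row g28-#2 (lane INBOX claim 2026-08-27), sequel of g27-#4 and g28-#1.
-/

set_option autoImplicit false

noncomputable section

open scoped Cardinal Pointwise
open NumberField Module IntermediateField

namespace Literature.NumberTheory.ComplexMultiplication

open Literature.AlgebraicGeometry.Motives (CMType)
open Literature.AlgebraicGeometry.Motives.HodgeStructure (cmTypeSmul cmTypeSmul_val)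
open Literature.FieldTheory.AlgClosed (Complex.mem_subfield_of_forall_ringEquiv)

variable {K : Type} [Field K] [NumberField K] (k₀ : IntermediateField ℚ K)

/-! ## §0 Preliminaries -/

section Prelim

/-- `(τφ)|_{k₀} = τ(φ|_{k₀})`. [folklore] -/
private theorem smul_comp_rc (τ : ℂ ≃+* ℂ) (φ : K →+* ℂ) :
    (τ • φ).comp (algebraMap k₀ K) = τ • φ.comp (algebraMap k₀ K) :=
  RingHom.ext fun _ => rfl

/-- `φ̄|_{k₀} = \overline{φ|_{k₀}}`. [folklore] -/
private theorem conjugate_comp_rc (φ : K →+* ℂ) :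
    (ComplexEmbedding.conjugate φ).comp (algebraMap k₀ K) = ComplexEmbedding.conjugate (φ.comp (algebraMap k₀ K)) :=
  (conjugate_comp_ringHom (algebraMap k₀ K) φ).symm

omit [NumberField K] in
/-- `conj ∘ conj = id` on complex embeddings. [folklore] -/
private theorem conjugate_conjugate_rc {E : Type} [Field E] (φ : E →+* ℂ) :
    ComplexEmbedding.conjugate (ComplexEmbedding.conjugate φ) = φ :=
  RingHom.ext fun x => by rw [ComplexEmbedding.conjugate_coe_eq, ComplexEmbedding.conjugate_coe_eq, Complex.conj_conj]

/-- `τφ̄ = \overline{τφ}` on the embeddings of a CM field. [cite: Shimura1998, §18.2 Lemma (i)] -/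
private theorem smul_conjugate_rc [IsCMField K] (τ : ℂ ≃+* ℂ) (φ : K →+* ℂ) :
    τ • ComplexEmbedding.conjugate φ = ComplexEmbedding.conjugate (τ • φ) := by
  refine RingHom.ext fun x => ?_
  change τ (starRingEnd ℂ (φ x)) = starRingEnd ℂ (τ (φ x))
  rw [← IsCMField.complexEmbedding_complexConj K φ x]
  exact IsCMField.complexEmbedding_complexConj K ((τ : ℂ →+* ℂ).comp φ) x

/-- Every embedding of `k₀` extends to `K` (the fibre has `[K : k₀] ≥ 1` elements). [cite: MilneFT2022, Prop. 2.7 (a)] -/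
private theorem exists_comp_eq_rc (ψ : k₀ →+* ℂ) : ∃ φ : K →+* ℂ, φ.comp (algebraMap k₀ K) = ψ := by
  have h := ncard_fibre_eq_finrank k₀ (K := K) ψ
  have hpos : 0 < {φ : K →+* ℂ | φ.comp (algebraMap k₀ K) = ψ}.ncard := by rw [h]; exact Module.finrank_pos
  obtain ⟨φ, hφ⟩ := Set.nonempty_of_ncard_ne_zero hpos.ne'
  exact ⟨φ, hφ⟩

/-- On the restrictions to `k₀` of embeddings of a CM field, conjugation commutes with `Aut(ℂ)`: `τψ̄ = \overline{τψ}` for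
every `ψ : k₀ → ℂ` (restrict `τφ̄ = \overline{τφ}` along an extension `φ` of `ψ`). [cite: Shimura1998, §18.2 Lemma (i)] -/
private theorem smul_conjugate_base_rc [IsCMField K] (τ : ℂ ≃+* ℂ) (ψ : k₀ →+* ℂ) :
    τ • ComplexEmbedding.conjugate ψ = ComplexEmbedding.conjugate (τ • ψ) := by
  obtain ⟨φ, rfl⟩ := exists_comp_eq_rc k₀ ψ
  rw [← conjugate_comp_rc, ← smul_comp_rc, smul_conjugate_rc, ← smul_comp_rc, conjugate_comp_rc]

/-- A number field inside `ℂ` is countable. [folklore] -/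
private theorem cardinalMk_toSubfield_le_aleph0_rc (M : IntermediateField ℚ ℂ) [FiniteDimensional ℚ M] :
    #M.toSubfield ≤ ℵ₀ := by
  rw [Cardinal.mk_le_aleph0_iff]
  exact Countable.of_equiv _ (Module.finBasis ℚ M).equivFun.toEquiv.symm

omit [NumberField K] in
/-- `K* = ℚ(tr_Φ)` is finite over `ℚ`. [folklore] -/
private theorem finiteDimensional_traceField_rc {E : Type} [Field E] [NumberField E] (Φ : CMType E) :
    FiniteDimensional ℚ (traceField Φ) :=
  Module.finite_of_finrank_pos (finrank_traceField_pos Φ)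

omit [NumberField K] in
/-- The image of an embedding of a number field is finite over `ℚ`. [folklore] -/
private theorem finiteDimensional_fieldRange_rc {E : Type} [Field E] [NumberField E] (s : E →+* ℂ) :
    FiniteDimensional ℚ s.toRatAlgHom.fieldRange :=
  LinearEquiv.finiteDimensional (AlgEquiv.ofInjectiveField s.toRatAlgHom).toLinearEquiv

omit [NumberField K] in
/-- `[s(E) : ℚ] = [E : ℚ]`. [folklore] -/
private theorem finrank_fieldRange_rc {E : Type} [Field E] [NumberField E] (s : E →+* ℂ) :
    finrank ℚ s.toRatAlgHom.fieldRange = finrank ℚ E := by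
  rw [← IntermediateField.finrank_eq_finrank_subalgebra, AlgHom.fieldRange_toSubalgebra]
  exact (AlgEquiv.ofInjectiveField s.toRatAlgHom).toLinearEquiv.finrank_eq.symm

omit [NumberField K] in
/-- `A ≤ B` inside `ℂ` `⟹ [A : ℚ] ∣ [B : ℚ]`. [cite: MilneFT2022, Prop. 1.20] -/
private theorem finrank_dvd_of_le_rc {A B : IntermediateField ℚ ℂ} (h : A ≤ B) : finrank ℚ A ∣ finrank ℚ B :=
  Dvd.intro _ (IntermediateField.finrank_bot_mul_relfinrank h)

end Prelim

/-! ## §1 The Kottwitz condition of signature `((1, n−1)_{φ₀}, (0, n)_{ψ ∈ Φ₀ ∖ {φ₀}})` and the Harris–Taylor hypotheses -/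

section Kottwitz

variable (Φ : CMType K)

/-- **The third clause of `r` holds for every CM type: `m_ψ = n − m_ψ̄`.** [cite: RapoportSmithlingZhang2017, Introduction p. 2]
[cite: Dodson1984, §3.1.0–3.1.1] -/
theorem ncard_inter_fibre_eq_sub (ψ : k₀ →+* ℂ) :
    {φ : K →+* ℂ | φ ∈ Φ.1 ∧ φ.comp (algebraMap k₀ K) = ψ}.ncard =
      finrank k₀ K - {φ : K →+* ℂ | φ ∈ Φ.1 ∧ φ.comp (algebraMap k₀ K) = ComplexEmbedding.conjugate ψ}.ncard := by
  have h := ncard_inter_fibre_add_ncard_inter_fibre_conjugate k₀ Φ ψ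
  omega

variable {Φ} {Φ₀ : CMType k₀} {φ₀ : k₀ →+* ℂ}
  (hφ₀ : φ₀ ∈ Φ₀.1)
  (h1 : {φ : K →+* ℂ | φ ∈ Φ.1 ∧ φ.comp (algebraMap k₀ K) = φ₀}.ncard = 1)
  (hΦ₀ : ∀ ψ : k₀ →+* ℂ, ψ ∈ Φ₀.1 → ψ ≠ φ₀ → {φ : K →+* ℂ | φ ∈ Φ.1 ∧ φ.comp (algebraMap k₀ K) = ψ}.ncard = 0)

include hΦ₀ in
/-- **`m_ψ = n` for `ψ ∉ Φ₀`, `ψ ≠ φ̄₀`** (RSZ's `(0, n)_{ψ ∈ Φ₀ ∖ {φ₀}}` read at `ψ̄`). [cite: RapoportSmithlingZhang2017, Introduction p. 2]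
[cite: RapoportSmithlingZhang2017, §3.2 (Kottwitz condition)] -/
theorem ncard_inter_fibre_eq_of_not_mem_of_ne_of_rsz {ψ : k₀ →+* ℂ} (hψ : ψ ∉ Φ₀.1)
    (hne : ψ ≠ ComplexEmbedding.conjugate φ₀) :
    {φ : K →+* ℂ | φ ∈ Φ.1 ∧ φ.comp (algebraMap k₀ K) = ψ}.ncard = finrank k₀ K := by
  have hmem : ComplexEmbedding.conjugate ψ ∈ Φ₀.1 := (Φ₀.2 _).2 (by rwa [conjugate_conjugate_rc])
  have hne' : ComplexEmbedding.conjugate ψ ≠ φ₀ := fun h => hne (by rw [← h, conjugate_conjugate_rc])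
  rw [ncard_inter_fibre_eq_sub k₀ Φ ψ, hΦ₀ _ hmem hne', Nat.sub_zero]

include hΦ₀ in
/-- **The Kottwitz condition relative to `(Φ₀, φ₀)` is BANAL away from `{φ₀, φ̄₀}`** (`m_ψ = 0` on `Φ₀ ∖ {φ₀}`, `= n` on
`Φ̄₀ ∖ {φ̄₀}`): g27-#4's hypothesis `hban`. [cite: RapoportSmithlingZhang2017, §3.2 and §4.1 («banal»)] -/
theorem ncard_inter_fibre_eq_zero_or_eq_of_rsz (ψ : k₀ →+* ℂ) (h0 : ψ ≠ φ₀) (hc : ψ ≠ ComplexEmbedding.conjugate φ₀) :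
    {φ : K →+* ℂ | φ ∈ Φ.1 ∧ φ.comp (algebraMap k₀ K) = ψ}.ncard = 0 ∨
      {φ : K →+* ℂ | φ ∈ Φ.1 ∧ φ.comp (algebraMap k₀ K) = ψ}.ncard = finrank k₀ K := by
  by_cases hψ : ψ ∈ Φ₀.1
  · exact Or.inl (hΦ₀ ψ hψ h0)
  · exact Or.inr (ncard_inter_fibre_eq_of_not_mem_of_ne_of_rsz k₀ hΦ₀ hψ hc)

include hφ₀ h1 hΦ₀ in
/-- **`n ≥ 3`: `Φ₀ = {ψ ∣ m_ψ ≤ 1}`** — the base type is determined by the signature (g28-#1's `mem_iff_apply_le_one` for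
`r = m`). [cite: RapoportSmithlingZhang2017, Introduction p. 2] -/
theorem mem_iff_ncard_inter_fibre_le_one_of_rsz (h3 : 3 ≤ finrank k₀ K) (ψ : k₀ →+* ℂ) :
    ψ ∈ Φ₀.1 ↔ {φ : K →+* ℂ | φ ∈ Φ.1 ∧ φ.comp (algebraMap k₀ K) = ψ}.ncard ≤ 1 :=
  mem_iff_apply_le_one (r := fun χ => {φ : K →+* ℂ | φ ∈ Φ.1 ∧ φ.comp (algebraMap k₀ K) = χ}.ncard) hφ₀ h1 hΦ₀
    (fun χ _ => ncard_inter_fibre_eq_sub k₀ Φ χ) h3 ψ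

include hφ₀ h1 hΦ₀ in
/-- `n ≥ 3`: **`Φ₀` is unique** — two base types for which `Φ` satisfies the Kottwitz condition relative to `φ₀` coincide.
[cite: RapoportSmithlingZhang2017, Introduction p. 2] -/
theorem eq_of_rsz (h3 : 3 ≤ finrank k₀ K) {Φ₀' : CMType k₀} (hφ₀' : φ₀ ∈ Φ₀'.1)
    (hΦ₀' : ∀ ψ : k₀ →+* ℂ, ψ ∈ Φ₀'.1 → ψ ≠ φ₀ → {φ : K →+* ℂ | φ ∈ Φ.1 ∧ φ.comp (algebraMap k₀ K) = ψ}.ncard = 0) :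
    Φ₀' = Φ₀ :=
  Subtype.ext (Set.ext fun ψ => by
    rw [mem_iff_ncard_inter_fibre_le_one_of_rsz k₀ hφ₀' h1 hΦ₀' h3,
      mem_iff_ncard_inter_fibre_le_one_of_rsz k₀ hφ₀ h1 hΦ₀ h3])

/-- **Conversely (`n ≥ 3`): the Harris–Taylor hypotheses of g27-#4 come from a base type** — if `m_{φ₀} = 1` and every
`ψ ∉ {φ₀, φ̄₀}` is banal, then `Φ₀ := {ψ ∣ m_ψ ≤ 1}` is a CM type of `k₀` containing `φ₀` relative to which `Φ` satisfies the
Kottwitz condition `((1, n−1)_{φ₀}, (0, n)_{ψ ∈ Φ₀ ∖ {φ₀}})`. [cite: RapoportSmithlingZhang2017, Introduction p. 2]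
[cite: RapoportSmithlingZhang2017, §3.2] -/
theorem exists_cmType_rsz_of_harrisTaylor {Φ : CMType K} {φ₀ : k₀ →+* ℂ}
    (h1 : {φ : K →+* ℂ | φ ∈ Φ.1 ∧ φ.comp (algebraMap k₀ K) = φ₀}.ncard = 1)
    (hban : ∀ ψ : k₀ →+* ℂ, ψ ≠ φ₀ → ψ ≠ ComplexEmbedding.conjugate φ₀ →
      {φ : K →+* ℂ | φ ∈ Φ.1 ∧ φ.comp (algebraMap k₀ K) = ψ}.ncard = 0 ∨
        {φ : K →+* ℂ | φ ∈ Φ.1 ∧ φ.comp (algebraMap k₀ K) = ψ}.ncard = finrank k₀ K)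
    (h3 : 3 ≤ finrank k₀ K) :
    ∃ Φ₀ : CMType k₀, φ₀ ∈ Φ₀.1 ∧ (∀ ψ : k₀ →+* ℂ, ψ ∈ Φ₀.1 → ψ ≠ φ₀ →
        {φ : K →+* ℂ | φ ∈ Φ.1 ∧ φ.comp (algebraMap k₀ K) = ψ}.ncard = 0) ∧
      ∀ ψ : k₀ →+* ℂ, ψ ∈ Φ₀.1 ↔ {φ : K →+* ℂ | φ ∈ Φ.1 ∧ φ.comp (algebraMap k₀ K) = ψ}.ncard ≤ 1 := by
  -- abbreviate the signature
  set m : (k₀ →+* ℂ) → ℕ := fun χ => {φ : K →+* ℂ | φ ∈ Φ.1 ∧ φ.comp (algebraMap k₀ K) = χ}.ncard with hm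
  have hsum : ∀ ψ : k₀ →+* ℂ, m ψ + m (ComplexEmbedding.conjugate ψ) = finrank k₀ K := fun ψ =>
    ncard_inter_fibre_add_ncard_inter_fibre_conjugate k₀ Φ ψ
  have h1' : m φ₀ = 1 := h1
  have hbar : m (ComplexEmbedding.conjugate φ₀) = finrank k₀ K - 1 := by have := hsum φ₀; omega
  -- the values of `m`: `≤ 1` or `≥ n − 1`
  have hval : ∀ ψ : k₀ →+* ℂ, m ψ ≤ 1 ∨ finrank k₀ K - 1 ≤ m ψ := fun ψ => by
    by_cases hψ0 : ψ = φ₀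
    · exact Or.inl (by rw [hψ0, h1'])
    by_cases hψ1 : ψ = ComplexEmbedding.conjugate φ₀
    · exact Or.inr (by rw [hψ1, hbar])
    rcases hban ψ hψ0 hψ1 with h | h
    · exact Or.inl (by change m ψ = 0 at h; omega)
    · exact Or.inr (by change m ψ = finrank k₀ K at h; omega)
  refine ⟨⟨{ψ | m ψ ≤ 1}, fun ψ => ?_⟩, ?_, fun ψ hψ hne => ?_, fun ψ => Iff.rfl⟩
  · -- `ψ ∈ Φ₀ ↔ ψ̄ ∉ Φ₀`
    change m ψ ≤ 1 ↔ ¬ m (ComplexEmbedding.conjugate ψ) ≤ 1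
    have hs := hsum ψ
    rcases hval ψ with h | h <;> rcases hval (ComplexEmbedding.conjugate ψ) with h' | h' <;> omega
  · change m φ₀ ≤ 1
    rw [h1']
  · -- `m_ψ = 0` on `Φ₀ ∖ {φ₀}`
    change m ψ ≤ 1 at hψ
    change m ψ = 0
    by_cases hψ1 : ψ = ComplexEmbedding.conjugate φ₀
    · rw [hψ1, hbar] at hψ; omega
    rcases hban ψ hne hψ1 with h | h
    · exact h
    · change m ψ = finrank k₀ K at h; omega

end Kottwitz

/-! ## §2 Stabilisers in `Aut(ℂ)`: `Stab(Φ) = Stab(m) ∩ Stab(σ₀) = Stab(Φ₀) ∩ Stab(σ₀)` -/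

section Stabilizer

variable [IsCMField K]

/-- **`τΦ = Φ ⟹ m_{τψ} = m_ψ` for every `ψ`** (ANY CM type `Φ`: the signature over `k₀` is an invariant of the stabiliser;
Dodson's `f ↦ f^α`). [cite: Dodson1984, §3.1.1 Theorem (proof)] [cite: Shimura1998, §8.3 Prop. 28] -/
theorem ncard_inter_fibre_smul_eq_of_forall_smul_mem_iff (Φ : CMType K) {τ : ℂ ≃+* ℂ}
    (hτ : ∀ χ : K →+* ℂ, τ • χ ∈ Φ.1 ↔ χ ∈ Φ.1) (ψ : k₀ →+* ℂ) :
    {φ : K →+* ℂ | φ ∈ Φ.1 ∧ φ.comp (algebraMap k₀ K) = τ • ψ}.ncard =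
      {φ : K →+* ℂ | φ ∈ Φ.1 ∧ φ.comp (algebraMap k₀ K) = ψ}.ncard := by
  have hfix : cmTypeSmul τ Φ = Φ := by
    refine Subtype.ext (Set.ext fun χ => ?_)
    rw [cmTypeSmul_val, Set.mem_smul_set_iff_inv_smul_mem, ← hτ (τ⁻¹ • χ), smul_inv_smul]
  have h := ncard_inter_fibre_cmTypeSmul k₀ τ Φ (τ • ψ)
  rwa [hfix, inv_smul_smul] at h

variable {Φ : CMType K} {φ₀ : k₀ →+* ℂ} {Φ₀ : CMType k₀} (hφ₀ : φ₀ ∈ Φ₀.1)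
  (h1 : {φ : K →+* ℂ | φ ∈ Φ.1 ∧ φ.comp (algebraMap k₀ K) = φ₀}.ncard = 1)
  (hban : ∀ ψ : k₀ →+* ℂ, ψ ≠ φ₀ → ψ ≠ ComplexEmbedding.conjugate φ₀ →
    {φ : K →+* ℂ | φ ∈ Φ.1 ∧ φ.comp (algebraMap k₀ K) = ψ}.ncard = 0 ∨
      {φ : K →+* ℂ | φ ∈ Φ.1 ∧ φ.comp (algebraMap k₀ K) = ψ}.ncard = finrank k₀ K)
  (hΦ₀ : ∀ ψ : k₀ →+* ℂ, ψ ∈ Φ₀.1 → ψ ≠ φ₀ → {φ : K →+* ℂ | φ ∈ Φ.1 ∧ φ.comp (algebraMap k₀ K) = ψ}.ncard = 0)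

include h1 hban in
/-- **`m ∘ τ = m ∧ τσ₀ = σ₀ ⟹ τΦ = Φ`** (any `n`; `σ₀` the special element above `φ₀`): `τ` carries the fibre above `ψ` to
the fibre above `τψ`, of the same multiplicity; the fibre of `Φ` above `φ₀` is `{σ₀}` (fixed), above `φ̄₀ = τφ̄₀` it is
`F_{φ̄₀} ∖ {σ̄₀}` whose image avoids `σ̄₀ = τσ̄₀`, and a banal fibre is empty or full.  So `τΦ ⊆ Φ`, equality by counting.
g27-#4's `forall_smul_mem_iff_of_smul_special_eq_of_harrisTaylor` is the case `τ|_{Hom(k₀,ℂ)} = id`.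
[cite: Howard2012, §3.1] [cite: Shimura1998, §8.3 Prop. 28] [cite: RapoportSmithlingZhang2017, §3.1 eq. (3.1)] -/
theorem forall_smul_mem_iff_of_forall_ncard_inter_fibre_smul_eq_of_smul_special_eq {σ₀ : K →+* ℂ} (hσ₀ : σ₀ ∈ Φ.1)
    (hσ₀ψ : σ₀.comp (algebraMap k₀ K) = φ₀) {τ : ℂ ≃+* ℂ}
    (hm : ∀ ψ : k₀ →+* ℂ, {φ : K →+* ℂ | φ ∈ Φ.1 ∧ φ.comp (algebraMap k₀ K) = τ • ψ}.ncard =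
      {φ : K →+* ℂ | φ ∈ Φ.1 ∧ φ.comp (algebraMap k₀ K) = ψ}.ncard)
    (hτσ : τ • σ₀ = σ₀) : ∀ χ : K →+* ℂ, τ • χ ∈ Φ.1 ↔ χ ∈ Φ.1 := by
  obtain ⟨σ₁, hσ₁, hσ₁ψ, huniq⟩ := (ncard_inter_fibre_eq_one_iff_exists_special k₀ Φ φ₀).1 h1
  have hσ₀₁ : σ₀ = σ₁ := huniq σ₀ hσ₀ (hσ₀ψ.trans hσ₁ψ.symm)
  have hτφ₀ : τ • φ₀ = φ₀ := by rw [← hσ₀ψ, ← smul_comp_rc, hτσ]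
  have hτφ₀bar : τ • ComplexEmbedding.conjugate φ₀ = ComplexEmbedding.conjugate φ₀ := by
    rw [smul_conjugate_base_rc, hτφ₀]
  -- `τΦ ⊆ Φ`
  have hsub : τ • Φ.1 ⊆ Φ.1 := by
    rintro _ ⟨φ, hφ, rfl⟩
    change τ • φ ∈ Φ.1
    have hres : (τ • φ).comp (algebraMap k₀ K) = τ • φ.comp (algebraMap k₀ K) := smul_comp_rc k₀ τ φ
    by_cases hψ0 : φ.comp (algebraMap k₀ K) = φ₀
    · -- `φ = σ₀`
      have hφσ : φ = σ₀ := (huniq φ hφ (hψ0.trans hσ₁ψ.symm)).trans hσ₀₁.symm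
      rw [hφσ, hτσ]
      exact hσ₀
    by_cases hψ1 : φ.comp (algebraMap k₀ K) = ComplexEmbedding.conjugate φ₀
    · -- above `φ̄₀`: `τφ` lies above `τφ̄₀ = φ̄₀` and `τφ ≠ σ̄₀` since `τΦ` is a CM type containing `σ₀ = τσ₀`
      have hres' : (τ • φ).comp (algebraMap k₀ K) = ComplexEmbedding.conjugate φ₀ := by rw [hres, hψ1, hτφ₀bar]
      refine mem_of_comp_eq_conjugate_of_ne_of_harrisTaylor k₀ h1 hσ₀ hσ₀ψ hres' fun h => ?_
      have hmem : τ • φ ∈ (cmTypeSmul τ Φ).1 := by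
        rw [cmTypeSmul_val]
        exact Set.smul_mem_smul_set hφ
      have hσmem : σ₀ ∈ (cmTypeSmul τ Φ).1 := by
        rw [cmTypeSmul_val, ← hτσ]
        exact Set.smul_mem_smul_set hσ₀
      rw [h] at hmem
      exact ((cmTypeSmul τ Φ).2 σ₀).1 hσmem hmem
    · -- banal fibre: `m_ψ = n`, hence `m_{τψ} = n` and the whole fibre above `τψ` lies in `Φ`
      have hn : {χ : K →+* ℂ | χ ∈ Φ.1 ∧ χ.comp (algebraMap k₀ K) = φ.comp (algebraMap k₀ K)}.ncard = finrank k₀ K := by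
        rcases hban _ hψ0 hψ1 with h0 | h0
        · exfalso
          rw [Set.ncard_eq_zero] at h0
          exact (Set.eq_empty_iff_forall_notMem.1 h0) φ ⟨hφ, rfl⟩
        · exact h0
      have hn' : {χ : K →+* ℂ | χ ∈ Φ.1 ∧ χ.comp (algebraMap k₀ K) = τ • φ.comp (algebraMap k₀ K)}.ncard =
          finrank k₀ K := by rw [hm, hn]
      exact mem_of_comp_eq_of_ncard_inter_fibre_eq_finrank k₀ Φ hn' hres
  -- equality by counting
  have heq : τ • Φ.1 = Φ.1 :=
    Set.eq_of_subset_of_ncard_le hsub (le_of_eq (Set.ncard_image_of_injective _ (MulAction.injective τ)).symm)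
  intro χ
  constructor
  · intro h
    rw [← heq] at h
    exact Set.smul_mem_smul_set_iff.1 h
  · intro h
    rw [← heq]
    exact Set.smul_mem_smul_set h

include h1 hban in
/-- **`n ≥ 3`: `Stab(Φ) = Stab(m) ∩ Stab(σ₀)`** — `τΦ = Φ` iff `τ` preserves the `k₀`-signature and fixes the special
element. [cite: Howard2012, §3.1] [cite: Shimura1998, §8.3 Prop. 28] [cite: RapoportSmithlingZhang2017, §3.1 eq. (3.1)] -/
theorem forall_smul_mem_iff_iff_of_harrisTaylor (h3 : 3 ≤ finrank k₀ K) {σ₀ : K →+* ℂ} (hσ₀ : σ₀ ∈ Φ.1)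
    (hσ₀ψ : σ₀.comp (algebraMap k₀ K) = φ₀) (τ : ℂ ≃+* ℂ) :
    (∀ χ : K →+* ℂ, τ • χ ∈ Φ.1 ↔ χ ∈ Φ.1) ↔
      (∀ ψ : k₀ →+* ℂ, {φ : K →+* ℂ | φ ∈ Φ.1 ∧ φ.comp (algebraMap k₀ K) = τ • ψ}.ncard =
          {φ : K →+* ℂ | φ ∈ Φ.1 ∧ φ.comp (algebraMap k₀ K) = ψ}.ncard) ∧ τ • σ₀ = σ₀ :=
  ⟨fun hτ => ⟨ncard_inter_fibre_smul_eq_of_forall_smul_mem_iff k₀ Φ hτ,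
      smul_special_eq_of_forall_smul_mem_iff_of_harrisTaylor k₀ h1 hban h3 hσ₀ hσ₀ψ hτ⟩,
    fun h => forall_smul_mem_iff_of_forall_ncard_inter_fibre_smul_eq_of_smul_special_eq k₀ h1 hban hσ₀ hσ₀ψ h.1 h.2⟩

/-! ### Relative to the base type `Φ₀` -/

omit [IsCMField K] in
include h1 hΦ₀ in
/-- **Membership in `Φ` through `Φ₀`: `φ ∈ Φ` iff `φ = σ₀` or (`φ ≠ σ̄₀` and `φ|_{k₀} ∉ Φ₀`)** (the fibres: `{σ₀}` above `φ₀`,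
`F_{φ̄₀} ∖ {σ̄₀}` above `φ̄₀`, full above `Φ̄₀ ∖ {φ̄₀}`, empty above `Φ₀ ∖ {φ₀}`; compare the pair-level structure theorem
`exists_cmType_flip_of_harrisTaylor` of g27-#2). [cite: RapoportSmithlingZhang2017, §3.2] [cite: Howard2012, §3.1] -/
theorem mem_iff_of_rsz {σ₀ : K →+* ℂ} (hσ₀ : σ₀ ∈ Φ.1) (hσ₀ψ : σ₀.comp (algebraMap k₀ K) = φ₀) (φ : K →+* ℂ) :
    φ ∈ Φ.1 ↔ φ = σ₀ ∨ (φ ≠ ComplexEmbedding.conjugate σ₀ ∧ φ.comp (algebraMap k₀ K) ∉ Φ₀.1) := by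
  obtain ⟨σ₁, hσ₁, hσ₁ψ, huniq⟩ := (ncard_inter_fibre_eq_one_iff_exists_special k₀ Φ φ₀).1 h1
  have hσ₀₁ : σ₀ = σ₁ := huniq σ₀ hσ₀ (hσ₀ψ.trans hσ₁ψ.symm)
  have hσbar : ComplexEmbedding.conjugate σ₀ ∉ Φ.1 := (Φ.2 σ₀).1 hσ₀
  constructor
  · intro hφ
    by_cases hψ0 : φ.comp (algebraMap k₀ K) = φ₀
    · exact Or.inl ((huniq φ hφ (hψ0.trans hσ₁ψ.symm)).trans hσ₀₁.symm)
    · refine Or.inr ⟨fun h => hσbar (h ▸ hφ), fun hmem => ?_⟩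
      have h0 := hΦ₀ _ hmem hψ0
      rw [Set.ncard_eq_zero] at h0
      exact (Set.eq_empty_iff_forall_notMem.1 h0) φ ⟨hφ, rfl⟩
  · rintro (rfl | ⟨hne, hnot⟩)
    · exact hσ₀
    · by_cases hψ1 : φ.comp (algebraMap k₀ K) = ComplexEmbedding.conjugate φ₀
      · exact mem_of_comp_eq_conjugate_of_ne_of_harrisTaylor k₀ h1 hσ₀ hσ₀ψ hψ1 hne
      · exact mem_of_comp_eq_of_ncard_inter_fibre_eq_finrank k₀ Φ
          (ncard_inter_fibre_eq_of_not_mem_of_ne_of_rsz k₀ hΦ₀ hnot hψ1) rfl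

include h1 hΦ₀ in
/-- **`τΦ₀ = Φ₀ ∧ τσ₀ = σ₀ ⟹ τΦ = Φ`** (any `n`): by the membership criterion through `Φ₀`, since `τ` fixes `σ₀` and
`σ̄₀ = \overline{τσ₀}` and carries `{φ ∣ φ|_{k₀} ∉ Φ₀}` to itself. [cite: RapoportSmithlingZhang2017, §3.1 eq. (3.1)]
[cite: Howard2012, §3.1] -/
theorem forall_smul_mem_iff_of_forall_smul_mem_iff_of_smul_special_eq_of_rsz {σ₀ : K →+* ℂ} (hσ₀ : σ₀ ∈ Φ.1)
    (hσ₀ψ : σ₀.comp (algebraMap k₀ K) = φ₀) {τ : ℂ ≃+* ℂ} (hτ₀ : ∀ ψ : k₀ →+* ℂ, τ • ψ ∈ Φ₀.1 ↔ ψ ∈ Φ₀.1)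
    (hτσ : τ • σ₀ = σ₀) (χ : K →+* ℂ) : τ • χ ∈ Φ.1 ↔ χ ∈ Φ.1 := by
  have hbar : τ • ComplexEmbedding.conjugate σ₀ = ComplexEmbedding.conjugate σ₀ := by rw [smul_conjugate_rc, hτσ]
  rw [mem_iff_of_rsz k₀ h1 hΦ₀ hσ₀ hσ₀ψ, mem_iff_of_rsz k₀ h1 hΦ₀ hσ₀ hσ₀ψ, smul_comp_rc, hτ₀]
  refine or_congr ⟨fun h => smul_left_cancel τ (h.trans hτσ.symm), fun h => by rw [h, hτσ]⟩ (and_congr_left fun _ => ?_)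
  exact not_congr ⟨fun h => smul_left_cancel τ (h.trans hbar.symm), fun h => by rw [h, hbar]⟩

include hφ₀ h1 hΦ₀ in
/-- **`n ≥ 3`: `τΦ = Φ ⟹ τΦ₀ = Φ₀`** (`τ` preserves `m`, and `Φ₀ = {m ≤ 1}`). [cite: RapoportSmithlingZhang2017, Introduction p. 2]
[cite: Shimura1998, §8.3 Prop. 28] -/
theorem forall_smul_mem_iff_base_of_forall_smul_mem_iff_of_rsz (h3 : 3 ≤ finrank k₀ K) {τ : ℂ ≃+* ℂ}
    (hτ : ∀ χ : K →+* ℂ, τ • χ ∈ Φ.1 ↔ χ ∈ Φ.1) (ψ : k₀ →+* ℂ) : τ • ψ ∈ Φ₀.1 ↔ ψ ∈ Φ₀.1 :=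
  forall_smul_mem_iff_of_forall_apply_smul_eq
    (r := fun χ => {φ : K →+* ℂ | φ ∈ Φ.1 ∧ φ.comp (algebraMap k₀ K) = χ}.ncard) hφ₀ h1 hΦ₀
    (fun χ _ => ncard_inter_fibre_eq_sub k₀ Φ χ) h3 (ncard_inter_fibre_smul_eq_of_forall_smul_mem_iff k₀ Φ hτ) ψ

include hφ₀ h1 hΦ₀ in
/-- **`n ≥ 3`: `Stab(Φ) = Stab(Φ₀) ∩ Stab(σ₀)`.** [cite: RapoportSmithlingZhang2017, §3.1 eq. (3.1)] [cite: Howard2012, §3.1]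
[cite: Shimura1998, §8.3 Prop. 28] -/
theorem forall_smul_mem_iff_iff_of_rsz (h3 : 3 ≤ finrank k₀ K) {σ₀ : K →+* ℂ} (hσ₀ : σ₀ ∈ Φ.1)
    (hσ₀ψ : σ₀.comp (algebraMap k₀ K) = φ₀) (τ : ℂ ≃+* ℂ) :
    (∀ χ : K →+* ℂ, τ • χ ∈ Φ.1 ↔ χ ∈ Φ.1) ↔ (∀ ψ : k₀ →+* ℂ, τ • ψ ∈ Φ₀.1 ↔ ψ ∈ Φ₀.1) ∧ τ • σ₀ = σ₀ := by
  have hban := ncard_inter_fibre_eq_zero_or_eq_of_rsz k₀ (Φ := Φ) hΦ₀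
  exact ⟨fun hτ => ⟨forall_smul_mem_iff_base_of_forall_smul_mem_iff_of_rsz k₀ hφ₀ h1 hΦ₀ h3 hτ,
      smul_special_eq_of_forall_smul_mem_iff_of_harrisTaylor k₀ h1 hban h3 hσ₀ hσ₀ψ hτ⟩,
    fun h => forall_smul_mem_iff_of_forall_smul_mem_iff_of_smul_special_eq_of_rsz k₀ h1 hΦ₀ hσ₀ hσ₀ψ h.1 h.2⟩

end Stabilizer

/-! ## §3 Reflex fields: `K* = E_{Φ₀} · σ₀(K) ⊇ E = E_{Φ₀} · φ₀(k₀)` -/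

section Reflex

variable [IsCMField K] {Φ : CMType K} {Φ₀ : CMType k₀} {φ₀ : k₀ →+* ℂ} (hφ₀ : φ₀ ∈ Φ₀.1)
  (h1 : {φ : K →+* ℂ | φ ∈ Φ.1 ∧ φ.comp (algebraMap k₀ K) = φ₀}.ncard = 1)
  (hΦ₀ : ∀ ψ : k₀ →+* ℂ, ψ ∈ Φ₀.1 → ψ ≠ φ₀ → {φ : K →+* ℂ | φ ∈ Φ.1 ∧ φ.comp (algebraMap k₀ K) = ψ}.ncard = 0)

include hφ₀ h1 hΦ₀ in
/-- **`n ≥ 3`: `E_{Φ₀} ⊆ K*`** — the reflex field of the base type lies in the reflex field of `Φ` (`Aut(ℂ/K*) = Stab(Φ)`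
stabilises `Φ₀`; Galois correspondence in `ℂ`). [cite: RapoportSmithlingZhang2017, §3.1 Remark 3.1 (i) and eq. (3.1)]
[cite: Shimura1998, §8.3 Prop. 28] -/
theorem traceField_base_le_traceField_of_rsz (h3 : 3 ≤ finrank k₀ K) : traceField Φ₀ ≤ traceField Φ := by
  haveI := finiteDimensional_traceField_rc Φ
  exact (traceField_le_iff_forall_smul_mem_iff_of_finiteDimensional Φ₀ (traceField Φ)).2 fun τ hτ =>
    forall_smul_mem_iff_base_of_forall_smul_mem_iff_of_rsz k₀ hφ₀ h1 hΦ₀ h3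
      (forall_smul_mem_iff_of_forall_apply_traceField_eq τ Φ hτ)

include hφ₀ h1 hΦ₀ in
/-- **`n ≥ 3`: `K* = E_{Φ₀} · σ₀(K)`** — THE REFLEX FIELD OF A CM TYPE WITH THE KOTTWITZ CONDITION RELATIVE TO `(Φ₀, φ₀)` IS THE
COMPOSITUM OF THE REFLEX FIELD OF THE BASE TYPE AND THE IMAGE OF THE SPECIAL ELEMENT (both are number fields in `ℂ` with
pointwise stabiliser `Stab(Φ₀) ∩ Stab(σ₀) = Stab(Φ)`).  Howard's «`K_Φ = φ^{sp}(K)`» is the case `k₀` imaginary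
quadratic (`E_{Φ₀} = φ₀(k₀) ⊆ σ₀(K)`). [cite: Howard2012, §3.1] [cite: RapoportSmithlingZhang2017, §3.1 eq. (3.1)]
[cite: Shimura1998, §8.3 Prop. 28] [cite: Lang2002, Ch. VIII §1] -/
theorem traceField_eq_traceField_sup_fieldRange_of_rsz (h3 : 3 ≤ finrank k₀ K) {σ₀ : K →+* ℂ} (hσ₀ : σ₀ ∈ Φ.1)
    (hσ₀ψ : σ₀.comp (algebraMap k₀ K) = φ₀) :
    traceField Φ = traceField Φ₀ ⊔ σ₀.toRatAlgHom.fieldRange := by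
  have hban := ncard_inter_fibre_eq_zero_or_eq_of_rsz k₀ (Φ := Φ) hΦ₀
  refine le_antisymm (fun z hz => ?_) (sup_le (traceField_base_le_traceField_of_rsz k₀ hφ₀ h1 hΦ₀ h3)
    (fieldRange_le_traceField_of_harrisTaylor k₀ h1 hban h3 hσ₀ hσ₀ψ))
  -- `K* ⊆ E_{Φ₀} · σ₀(K)`: an automorphism fixing the compositum fixes `Φ₀` and `σ₀`, hence `Φ`, hence `K*`
  haveI := finiteDimensional_traceField_rc Φ₀
  haveI := finiteDimensional_fieldRange_rc σ₀
  haveI : FiniteDimensional ℚ (traceField Φ₀ ⊔ σ₀.toRatAlgHom.fieldRange : IntermediateField ℚ ℂ) :=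
    IntermediateField.finiteDimensional_sup _ _
  refine Complex.mem_subfield_of_forall_ringEquiv (traceField Φ₀ ⊔ σ₀.toRatAlgHom.fieldRange).toSubfield
    (cardinalMk_toSubfield_le_aleph0_rc _) fun τ hτ => ?_
  have hτ' := (forall_mem_sup_iff τ (traceField Φ₀) σ₀.toRatAlgHom.fieldRange).1 hτ
  exact forall_apply_eq_of_forall_smul_mem_iff τ Φ
    (forall_smul_mem_iff_of_forall_smul_mem_iff_of_smul_special_eq_of_rsz k₀ h1 hΦ₀ hσ₀ hσ₀ψ
      (forall_smul_mem_iff_of_forall_apply_traceField_eq τ Φ₀ hτ'.1)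
      ((forall_mem_fieldRange_iff_smul_eq τ σ₀).1 hτ'.2)) z hz

include hφ₀ h1 hΦ₀ in
/-- **`n ≥ 3`: RSZ's REFLEX FIELD `E = E_{Φ₀} · φ₀(k₀)` LIES IN `K*`** (`φ₀(k₀) = σ₀(k₀) ⊆ σ₀(K)`): the reflex field of a CM
point's type contains the reflex field of the Shimura datum. [cite: RapoportSmithlingZhang2017, §3.1 eq. (3.1) and §3.2]
[cite: Howard2012, §3.1] -/
theorem traceField_sup_fieldRange_le_traceField_of_rsz (h3 : 3 ≤ finrank k₀ K) :
    traceField Φ₀ ⊔ φ₀.toRatAlgHom.fieldRange ≤ traceField Φ := by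
  have hban := ncard_inter_fibre_eq_zero_or_eq_of_rsz k₀ (Φ := Φ) hΦ₀
  obtain ⟨σ₀, hσ₀, hσ₀ψ, -⟩ := (ncard_inter_fibre_eq_one_iff_exists_special k₀ Φ φ₀).1 h1
  refine sup_le (traceField_base_le_traceField_of_rsz k₀ hφ₀ h1 hΦ₀ h3) fun z hz => ?_
  obtain ⟨x, rfl⟩ := AlgHom.mem_fieldRange.1 hz
  refine fieldRange_le_traceField_of_harrisTaylor k₀ h1 hban h3 hσ₀ hσ₀ψ (AlgHom.mem_fieldRange.2 ⟨algebraMap k₀ K x, ?_⟩)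
  change σ₀ (algebraMap k₀ K x) = φ₀ x
  rw [← hσ₀ψ]
  rfl

include hφ₀ h1 hΦ₀ in
/-- `n ≥ 3`: `Aut(ℂ/K*) ≤ Aut(ℂ/E)` — an automorphism fixing `K*` pointwise fixes `Φ₀` and `φ₀`.
[cite: RapoportSmithlingZhang2017, §3.1 eq. (3.1)] [cite: Shimura1998, §8.3 Prop. 28] -/
theorem forall_smul_mem_iff_base_and_smul_eq_of_forall_apply_traceField_eq (h3 : 3 ≤ finrank k₀ K) {τ : ℂ ≃+* ℂ}
    (hτ : ∀ z : ℂ, z ∈ traceField Φ → τ z = z) :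
    (∀ ψ : k₀ →+* ℂ, τ • ψ ∈ Φ₀.1 ↔ ψ ∈ Φ₀.1) ∧ τ • φ₀ = φ₀ :=
  (forall_mem_traceField_sup_fieldRange_iff Φ₀ φ₀ τ).1 fun z hz =>
    hτ z (traceField_sup_fieldRange_le_traceField_of_rsz k₀ hφ₀ h1 hΦ₀ h3 hz)

include hφ₀ h1 hΦ₀ in
/-- **`n ≥ 3`: `K*` IS THE FIXED FIELD OF `Stab(Φ₀) ∩ Stab(σ₀)`.** [cite: RapoportSmithlingZhang2017, §3.1 eq. (3.1)]
[cite: Howard2012, §3.1] [cite: Lang2002, Ch. VIII §1] -/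
theorem mem_traceField_iff_forall_of_rsz (h3 : 3 ≤ finrank k₀ K) {σ₀ : K →+* ℂ} (hσ₀ : σ₀ ∈ Φ.1)
    (hσ₀ψ : σ₀.comp (algebraMap k₀ K) = φ₀) (z : ℂ) :
    z ∈ traceField Φ ↔
      ∀ τ : ℂ ≃+* ℂ, (∀ ψ : k₀ →+* ℂ, τ • ψ ∈ Φ₀.1 ↔ ψ ∈ Φ₀.1) → τ • σ₀ = σ₀ → τ z = z := by
  rw [mem_traceField_iff_forall_smul_mem_iff]
  refine ⟨fun h τ hτ₀ hτσ => h τ ((forall_smul_mem_iff_iff_of_rsz k₀ hφ₀ h1 hΦ₀ h3 hσ₀ hσ₀ψ τ).2 ⟨hτ₀, hτσ⟩),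
    fun h τ hτ => ?_⟩
  have h' := (forall_smul_mem_iff_iff_of_rsz k₀ hφ₀ h1 hΦ₀ h3 hσ₀ hσ₀ψ τ).1 hτ
  exact h τ h'.1 h'.2

include hφ₀ h1 hΦ₀ in
/-- `n ≥ 3`: **`[E_{Φ₀} : ℚ] ∣ [K* : ℚ]`.** [cite: RapoportSmithlingZhang2017, §3.1 Remark 3.1 (i)] [cite: MilneFT2022, Prop. 1.20] -/
theorem finrank_traceField_base_dvd_of_rsz (h3 : 3 ≤ finrank k₀ K) :
    finrank ℚ (traceField Φ₀) ∣ finrank ℚ (traceField Φ) :=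
  finrank_dvd_of_le_rc (traceField_base_le_traceField_of_rsz k₀ hφ₀ h1 hΦ₀ h3)

include hφ₀ h1 hΦ₀ in
/-- `n ≥ 3`: **`[E : ℚ] ∣ [K* : ℚ]`** for RSZ's `E = E_{Φ₀} · φ₀(k₀)`. [cite: RapoportSmithlingZhang2017, §3.1 eq. (3.1)]
[cite: MilneFT2022, Prop. 1.20] -/
theorem finrank_traceField_sup_fieldRange_dvd_of_rsz (h3 : 3 ≤ finrank k₀ K) :
    finrank ℚ (traceField Φ₀ ⊔ φ₀.toRatAlgHom.fieldRange : IntermediateField ℚ ℂ) ∣ finrank ℚ (traceField Φ) :=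
  finrank_dvd_of_le_rc (traceField_sup_fieldRange_le_traceField_of_rsz k₀ hφ₀ h1 hΦ₀ h3)

include h1 hΦ₀ in
/-- `n ≥ 3`: **`[K : ℚ] ∣ [K* : ℚ]`** (`σ₀(K) ⊆ K*`; g27-#4 has `≤`). [cite: Howard2012, §3.1] [cite: MilneFT2022, Prop. 1.20] -/
theorem finrank_dvd_finrank_traceField_of_rsz (h3 : 3 ≤ finrank k₀ K) : finrank ℚ K ∣ finrank ℚ (traceField Φ) := by
  have hban := ncard_inter_fibre_eq_zero_or_eq_of_rsz k₀ (Φ := Φ) hΦ₀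
  obtain ⟨σ₀, hσ₀, hσ₀ψ, -⟩ := (ncard_inter_fibre_eq_one_iff_exists_special k₀ Φ φ₀).1 h1
  rw [← finrank_fieldRange_rc σ₀]
  exact finrank_dvd_of_le_rc (fieldRange_le_traceField_of_harrisTaylor k₀ h1 hban h3 hσ₀ hσ₀ψ)

include hφ₀ h1 hΦ₀ in
/-- `n ≥ 3`: **`[K* : ℚ] ≤ [E_{Φ₀} : ℚ] · [K : ℚ]`** (degree of the compositum `E_{Φ₀} · σ₀(K)`).
[cite: MilneFT2022, Cor. 3.19 (`[EL : F] ≤ [E : F][L : F]`)] [cite: Howard2012, §3.1] -/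
theorem finrank_traceField_le_mul_of_rsz (h3 : 3 ≤ finrank k₀ K) :
    finrank ℚ (traceField Φ) ≤ finrank ℚ (traceField Φ₀) * finrank ℚ K := by
  obtain ⟨σ₀, hσ₀, hσ₀ψ, -⟩ := (ncard_inter_fibre_eq_one_iff_exists_special k₀ Φ φ₀).1 h1
  haveI := finiteDimensional_traceField_rc Φ₀
  haveI := finiteDimensional_fieldRange_rc σ₀
  rw [traceField_eq_traceField_sup_fieldRange_of_rsz k₀ hφ₀ h1 hΦ₀ h3 hσ₀ hσ₀ψ, ← finrank_fieldRange_rc σ₀]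
  exact IntermediateField.finrank_sup_le _ _

include hφ₀ h1 hΦ₀ in
/-- **`n ≥ 3`: `K* = σ₀(K)` iff `E_{Φ₀} ⊆ σ₀(K)`** — the correction term to Howard's formula is exactly the reflex field of the
base type. [cite: Howard2012, §3.1] [cite: RapoportSmithlingZhang2017, §3.1 Remark 3.1 (i)] -/
theorem traceField_eq_fieldRange_iff_of_rsz (h3 : 3 ≤ finrank k₀ K) {σ₀ : K →+* ℂ} (hσ₀ : σ₀ ∈ Φ.1)
    (hσ₀ψ : σ₀.comp (algebraMap k₀ K) = φ₀) :
    traceField Φ = σ₀.toRatAlgHom.fieldRange ↔ traceField Φ₀ ≤ σ₀.toRatAlgHom.fieldRange := by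
  rw [traceField_eq_traceField_sup_fieldRange_of_rsz k₀ hφ₀ h1 hΦ₀ h3 hσ₀ hσ₀ψ]
  exact sup_eq_right

include hφ₀ h1 hΦ₀ in
/-- **`n ≥ 3`: `K* = σ₀(K)` iff `Stab(σ₀) ≤ Stab(Φ₀)`**, i.e. iff every automorphism of `ℂ` fixing `σ₀(K)` stabilises the
base type; g27-#4's sufficient condition «`Aut(ℂ/φ₀(k₀))` fixes `Hom(k₀, ℂ)`» (`hfix`, automatic for `k₀/ℚ` normal) is the
case where such `τ` fix every `ψ`. [cite: Howard2012, §3.1] [cite: Shimura1998, §8.3 Prop. 28] [cite: Lang2002, Ch. VIII §1] -/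
theorem traceField_eq_fieldRange_iff_forall_of_rsz (h3 : 3 ≤ finrank k₀ K) {σ₀ : K →+* ℂ} (hσ₀ : σ₀ ∈ Φ.1)
    (hσ₀ψ : σ₀.comp (algebraMap k₀ K) = φ₀) :
    traceField Φ = σ₀.toRatAlgHom.fieldRange ↔
      ∀ τ : ℂ ≃+* ℂ, τ • σ₀ = σ₀ → ∀ ψ : k₀ →+* ℂ, τ • ψ ∈ Φ₀.1 ↔ ψ ∈ Φ₀.1 := by
  haveI := finiteDimensional_fieldRange_rc σ₀
  rw [traceField_eq_fieldRange_iff_of_rsz k₀ hφ₀ h1 hΦ₀ h3 hσ₀ hσ₀ψ,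
    traceField_le_iff_forall_smul_mem_iff_of_finiteDimensional]
  refine forall_congr' fun τ => ?_
  rw [forall_mem_fieldRange_iff_smul_eq]

include hφ₀ h1 hΦ₀ in
/-- `n ≥ 3`: the `hfix` case of g27-#4 recovered — if `Aut(ℂ/φ₀(k₀))` fixes `Hom(k₀, ℂ)` then `E_{Φ₀} ⊆ σ₀(K)` and
`K* = σ₀(K)`. [cite: Howard2012, §3.1] [cite: MilneFT2022, Cor. 3.10] -/
theorem traceField_base_le_fieldRange_of_rsz (h3 : 3 ≤ finrank k₀ K) {σ₀ : K →+* ℂ} (hσ₀ : σ₀ ∈ Φ.1)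
    (hσ₀ψ : σ₀.comp (algebraMap k₀ K) = φ₀) (hfix : ∀ (τ : ℂ ≃+* ℂ) (ψ : k₀ →+* ℂ), τ • φ₀ = φ₀ → τ • ψ = ψ) :
    traceField Φ₀ ≤ σ₀.toRatAlgHom.fieldRange := by
  rw [← traceField_eq_fieldRange_iff_of_rsz k₀ hφ₀ h1 hΦ₀ h3 hσ₀ hσ₀ψ]
  exact traceField_eq_fieldRange_of_harrisTaylor k₀ h1 (ncard_inter_fibre_eq_zero_or_eq_of_rsz k₀ (Φ := Φ) hΦ₀) h3
    hσ₀ hσ₀ψ hfix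

end Reflex

/-! ## §4 The same through g27-#4's hypotheses `(h1, hban)` alone (`n ≥ 3`; the base type is `{m ≤ 1}`) -/

section HarrisTaylor

variable [IsCMField K] {Φ : CMType K} {φ₀ : k₀ →+* ℂ}
  (h1 : {φ : K →+* ℂ | φ ∈ Φ.1 ∧ φ.comp (algebraMap k₀ K) = φ₀}.ncard = 1)
  (hban : ∀ ψ : k₀ →+* ℂ, ψ ≠ φ₀ → ψ ≠ ComplexEmbedding.conjugate φ₀ →
    {φ : K →+* ℂ | φ ∈ Φ.1 ∧ φ.comp (algebraMap k₀ K) = ψ}.ncard = 0 ∨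
      {φ : K →+* ℂ | φ ∈ Φ.1 ∧ φ.comp (algebraMap k₀ K) = ψ}.ncard = finrank k₀ K)

include h1 hban in
/-- **`n ≥ 3`: `K*` IS THE FIXED FIELD OF `Stab(m) ∩ Stab(σ₀)`** — a complex number lies in the reflex field iff it is fixed by
every automorphism of `ℂ` preserving the `k₀`-signature and the special element. [cite: Howard2012, §3.1]
[cite: RapoportSmithlingZhang2017, §3.1 eq. (3.1)] [cite: Lang2002, Ch. VIII §1] -/
theorem mem_traceField_iff_forall_of_harrisTaylor (h3 : 3 ≤ finrank k₀ K) {σ₀ : K →+* ℂ} (hσ₀ : σ₀ ∈ Φ.1)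
    (hσ₀ψ : σ₀.comp (algebraMap k₀ K) = φ₀) (z : ℂ) :
    z ∈ traceField Φ ↔
      ∀ τ : ℂ ≃+* ℂ, (∀ ψ : k₀ →+* ℂ, {φ : K →+* ℂ | φ ∈ Φ.1 ∧ φ.comp (algebraMap k₀ K) = τ • ψ}.ncard =
          {φ : K →+* ℂ | φ ∈ Φ.1 ∧ φ.comp (algebraMap k₀ K) = ψ}.ncard) → τ • σ₀ = σ₀ → τ z = z := by
  rw [mem_traceField_iff_forall_smul_mem_iff]
  refine ⟨fun h τ hm hτσ => h τ ((forall_smul_mem_iff_iff_of_harrisTaylor k₀ h1 hban h3 hσ₀ hσ₀ψ τ).2 ⟨hm, hτσ⟩),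
    fun h τ hτ => ?_⟩
  have h' := (forall_smul_mem_iff_iff_of_harrisTaylor k₀ h1 hban h3 hσ₀ hσ₀ψ τ).1 hτ
  exact h τ h'.1 h'.2

include h1 hban in
/-- `n ≥ 3`: **`[K : ℚ] ∣ [K* : ℚ]`** under the Harris–Taylor hypotheses (`σ₀(K) ⊆ K*`). [cite: Howard2012, §3.1]
[cite: MilneFT2022, Prop. 1.20] -/
theorem finrank_dvd_finrank_traceField_of_harrisTaylor (h3 : 3 ≤ finrank k₀ K) :
    finrank ℚ K ∣ finrank ℚ (traceField Φ) := by
  obtain ⟨σ₀, hσ₀, hσ₀ψ, -⟩ := (ncard_inter_fibre_eq_one_iff_exists_special k₀ Φ φ₀).1 h1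
  rw [← finrank_fieldRange_rc σ₀]
  exact finrank_dvd_of_le_rc (fieldRange_le_traceField_of_harrisTaylor k₀ h1 hban h3 hσ₀ hσ₀ψ)

include h1 hban in
/-- `n ≥ 3`: **there is a base type `Φ₀ ∋ φ₀` with `K* = E_{Φ₀} · σ₀(K)` and `E_{Φ₀} · φ₀(k₀) ⊆ K*`** (the base type of
`exists_cmType_rsz_of_harrisTaylor`). [cite: Howard2012, §3.1] [cite: RapoportSmithlingZhang2017, §3.1 eq. (3.1)] -/
theorem exists_cmType_traceField_eq_of_harrisTaylor (h3 : 3 ≤ finrank k₀ K) {σ₀ : K →+* ℂ} (hσ₀ : σ₀ ∈ Φ.1)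
    (hσ₀ψ : σ₀.comp (algebraMap k₀ K) = φ₀) :
    ∃ Φ₀ : CMType k₀, φ₀ ∈ Φ₀.1 ∧ traceField Φ = traceField Φ₀ ⊔ σ₀.toRatAlgHom.fieldRange ∧
      traceField Φ₀ ⊔ φ₀.toRatAlgHom.fieldRange ≤ traceField Φ := by
  obtain ⟨Φ₀, hφ₀, hΦ₀, -⟩ := exists_cmType_rsz_of_harrisTaylor k₀ h1 hban h3
  exact ⟨Φ₀, hφ₀, traceField_eq_traceField_sup_fieldRange_of_rsz k₀ hφ₀ h1 hΦ₀ h3 hσ₀ hσ₀ψ,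
    traceField_sup_fieldRange_le_traceField_of_rsz k₀ hφ₀ h1 hΦ₀ h3⟩

end HarrisTaylor

end Literature.NumberTheory.ComplexMultiplication

end
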